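import Literature.Probability.Percolation.SlabRSWGluingHighProbSeg
import Literature.Probability.Percolation.SlabRSWGluingHighProbTop
import Literature.Probability.Percolation.SlabRSWHalfSide
import Literature.Probability.Percolation.SlabRSWRectCrossings
import Literature.Probability.Percolation.SlabRSWProp39Iter
import Literature.Probability.Percolation.SlabRSWLemma311
import Literature.Probability.Percolation.SlabRSWLemma315
import HarnessLib

/-!
# Newman–Tassion–Wu 2017, Proposition 3.9 (1) in the HIGH-PROBABILITY regime (`ε-δ` form)

Topic: `Literature/Probability/Percolation`. NTW's Prop. 3.9 (1) (`f_p(n+jκn,n) ≥ h₂^{j-1}(f_p(n+κn,n))`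
with `h₂ ∈ 𝓗`, so `h₂(x) → 1` as `x → 1`) in the form consumed by the tree's assembly of Theorem 3.1
(`Crossing.NewmanTassionWu2017_thm31_of_five`, hypothesis `h39`): for every `ε, η > 0` and `j ≥ 1`
there is `δ > 0` with `f_p(2m, m-1) ≥ 1-δ ⟹ f_p(jm, m-1) ≥ 1-η` for all `p ∈ [ε, 1-ε]` and all large
`m`. Written in the TALL orientation (`f_p(H, n)` = the top-bottom crossing probability of
`[a, a+n] × [c, c+H]`):

* `top_leftLow_highProb` — (3.28): if the tall rectangle `R = [a,a+n]×[c,d']` is crossed top-to-bottom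
  with probability `≥ 1-δ`, its top row is joined inside `R` to the lower-left segment `{a}×[c,c+h]`
  (`n ≤ 2h+1`) with probability `≥ 1-η` (square-root trick in the bottom square + the lead's
  `glue0_highProb_topExt`); `top_rightLow_highProb`, `bottom_rightHigh_highProb` (reflections);
* `tb_extend_highProb` — (3.29): from height `H` to height `H + n + 1` (`glue0_highProb_segExt`: the
  minimal path from the bottom row to a right-side segment at height `≈ H`, glued to the top-row cluster
  reaching a right-side segment at height `≈ H' - H`, the two segments interleaved);
* `crossingProb_highProb_iter`, **`prop39_one_highProb`**: the `ε-δ` statement for `f_p(jm, m-1)`.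

## Sources

* C. M. Newman, V. Tassion, W. Wu, *Critical percolation and the minimal spanning tree in slabs*,
  Comm. Pure Appl. Math. 70 (2017), arXiv:1512.09107: §3.3, Proposition 3.9 (1) and its proof
  ((3.27)–(3.29)), with Theorem 3.6/3.7 in the high-probability regime [NewmanTassionWu2017].
-/

noncomputable section

namespace Literature.Probability.Percolation

open MeasureTheory LatticeModels SimpleGraph

namespace NTW17

variable {k : ℕ}

/-! ## Elementary conversions -/

/-- The top-bottom crossing probability of `[a,a+n]×[c,c+H]` is `f_p(H, n)`.
[cite: NewmanTassionWu2017, §3 ((3.1)), §3.3 ("by symmetry")] -/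
theorem real_tb_eq_crossingProb (a c : ℤ) (n H : ℕ) (p : unitInterval) :
    (bondPercolation (slabGraph 3 k) p).real
        (slabConn k (boxR a (a + n) c (c + H)) {z | z.2 = c + H} {z | z.2 = c}) = crossingProb k p H n := by
  rw [Literature.Probability.Percolation.slabConn_comm, real_bt_eq_lr, crossingProb_eq]
  have h := real_lr_shift (k := k) ((c, a) : ℤ × ℤ) 0 H 0 n p
  dsimp only at h
  rw [zero_add, zero_add, add_comm (H : ℤ) c, add_comm (n : ℤ) a] at h
  exact h

/-- A taller rectangle is harder to cross top-to-bottom than the square at its bottom is to cross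
left-to-right: `P[T ⟷ B in [a,a+n]×[c,d']] ≤ P[L ⟷ R in [a,a+n]×[c,c+n]]` (`c + n ≤ d'`).
[cite: NewmanTassionWu2017, §3.3 (proof of Proposition 3.9, "f_p(n,n) ≥ f_p(n+κn,n)")] -/
theorem real_tb_le_lr_square {a c d' : ℤ} {n : ℕ} (hd : c + n ≤ d') (p : unitInterval) :
    (bondPercolation (slabGraph 3 k) p).real (slabConn k (boxR a (a + n) c d') {z | z.2 = d'} {z | z.2 = c}) ≤
      (bondPercolation (slabGraph 3 k) p).real
        (slabConn k (boxR a (a + n) c (c + n)) {z | z.1 = a} {z | z.1 = a + n}) := by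
  rw [Literature.Probability.Percolation.slabConn_comm, real_bt_eq_lr]
  have h1 := real_lr_wider_le (k := k) (a := c) (b := c + n) (b' := d') (c := a) (d := a + n)
    (by omega) hd p
  refine h1.trans (le_of_eq ?_)
  have h := real_lr_shift (k := k) ((c - a, a - c) : ℤ × ℤ) a (a + n) c (c + n) p
  have e1 : a + (c - a) = c := by ring
  have e2 : a + n + (c - a) = c + n := by ring
  have e3 : c + (a - c) = a := by ring
  have e4 : c + n + (a - c) = a + n := by ring
  dsimp only at h
  rw [e1, e2, e3, e4] at h
  exact h

/-! ## (3.28): the top row is joined to a lower-left segment -/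

/-- **(3.28) in the high-probability regime**: for every `k ≥ 1`, `ρ ≥ 2`, `ε > 0`, `η > 0` there is
`δ > 0` such that for every tall rectangle `R = [a,a+n]×[c,d']` (`3 ≤ n ≤ 2h+1`, `h ≤ n`,
`c + n + h + 4ρ + 9 ≤ d'`) and `p ∈ [ε,1-ε]`: if `R` is crossed top-to-bottom with probability `≥ 1-δ`,
then its top row is joined inside `R` to `{a} × [c, c+h]` with probability `≥ 1-η`.
[cite: NewmanTassionWu2017, Proposition 3.9 (proof, (3.27)–(3.28))] -/
theorem top_leftLow_highProb (k ρ : ℕ) (hk : 1 ≤ k) (hρ : 2 ≤ ρ) {ε : ℝ} (hε : 0 < ε) {η : ℝ} (hη : 0 < η) :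
    ∃ δ : ℝ, 0 < δ ∧ ∀ (a c d' : ℤ) (n h : ℕ), 3 ≤ n → n ≤ 2 * h + 1 → h ≤ n →
      c + n + h + 4 * ρ + 9 ≤ d' →
      ∀ (p : unitInterval), ε ≤ (p : ℝ) → (p : ℝ) ≤ 1 - ε →
      1 - δ ≤ (bondPercolation (slabGraph 3 k) p).real
        (slabConn k (boxR a (a + n) c d') {z | z.2 = d'} {z | z.2 = c}) →
      1 - η ≤ (bondPercolation (slabGraph 3 k) p).real
        (slabConn k (boxR a (a + n) c d') {z | z.2 = d'} (sideSeg a c (c + h))) := by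
  obtain ⟨δ₀, hδ₀, H⟩ := glue0_highProb_topExt k ρ hk hρ hε hη
  set δ₁ : ℝ := min δ₀ 1 with hδ₁
  have hδ₁0 : 0 < δ₁ := lt_min hδ₀ one_pos
  have hδ₁1 : δ₁ ≤ 1 := min_le_right _ _
  have hδ₁δ : δ₁ ≤ δ₀ := min_le_left _ _
  refine ⟨δ₁ ^ 2, by positivity, fun a c d' n h hn hnh hhn hsep p hpε hp1 hTB => ?_⟩
  set P := bondPercolation (slabGraph 3 k) p with hP
  have hsq1 : δ₁ ^ 2 ≤ δ₁ := by nlinarith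
  -- the extended-rectangle datum: `S` the bottom square, `R` the tall rectangle, `A` the segment
  let E : ExtSetup :=
    { a := a, b := a + n, c := c, d := c + n, b' := a + n, d' := d'
      A := sideSeg a c (c + h), C := {z | z.2 = d' ∧ a ≤ z.1 ∧ z.1 ≤ a + n}
      hab := by omega, hcd := by omega, hbb' := le_rfl, hdd' := by omega
      hA := by intro z hz; rw [sideSeg, Set.mem_setOf_eq] at hz; rw [mem_boxR_iff]; omega
      hAB := by intro z hz; rw [sideSeg, Set.mem_setOf_eq] at hz; omega
      hC := by intro z hz; simp only [Set.mem_setOf_eq] at hz; rw [mem_boxR_iff]; omega }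
  have hmain := H E {z | z.2 = c} rfl (fun z hz => hz.1) (fun z hz => hz.1) (fun z hz => hz)
    (fun a' ha' c' hc' hmem => by
      simp only [E, sideSeg, Set.mem_setOf_eq] at ha' hc'
      rw [mem_sqBox_iff'] at hmem; push_cast at hmem; omega)
    (fun c' hc' s' hs' hmem => by
      simp only [E, Set.mem_setOf_eq] at hc'
      have hs'' : s' ∈ boxR a (a + n) c (c + n) := hs'
      rw [mem_boxR_iff] at hs''
      rw [mem_sqBox_iff'] at hmem; push_cast at hmem; omega)
    p hpε hp1
  -- hypothesis 1: the square-root trick in the bottom square (transposed)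
  have hLR : 1 - δ₁ ^ 2 ≤ P.real (slabConn k (boxR a (a + n) c (c + n)) {z | z.1 = a} {z | z.1 = a + n}) :=
    hTB.trans (real_tb_le_lr_square (by omega) p)
  have hAB : 1 - δ₁ ≤ P.real (E.Q.evAB k) := by
    -- the square-root trick in the transposed square `[c,c+n]×[a,a+n]`, then the swap
    have hsq := real_halfBottom_top_ge (k := k) (a := c) (b := c + n) (c := a) (d := a + n) (m := c + h)
      (by omega) p
    have hbt : P.real (slabConn k (boxR c (c + n) a (a + n)) {z | z.2 = a} {z | z.2 = a + n}) =
        P.real (slabConn k (boxR a (a + n) c (c + n)) {z | z.1 = a} {z | z.1 = a + n}) :=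
      real_bt_eq_lr c (c + n) a (a + n) p
    have hswap : P.real (slabConn k (boxR c (c + n) a (a + n)) {z | z.2 = a ∧ c ≤ z.1 ∧ z.1 ≤ c + h}
        {z | z.2 = a + n}) = P.real (slabConn k (boxR a (a + n) c (c + n)) (sideSeg a c (c + h)) {z | z.1 = a + n}) := by
      have hS : planarSwap '' boxR c (c + n) a (a + n) = boxR a (a + n) c (c + n) := image_planarSwap_boxR _ _ _ _
      have hX : planarSwap '' {z : ℤ × ℤ | z.2 = a ∧ c ≤ z.1 ∧ z.1 ≤ c + h} = sideSeg a c (c + h) := by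
        rw [image_planarSwap_eq]; ext z; simp [sideSeg]
      have hY : planarSwap '' {z : ℤ × ℤ | z.2 = a + n} = {z | z.1 = a + n} := by
        rw [image_planarSwap_eq]; ext z; simp
      rw [← hS, ← hX, ← hY, real_slabConn_image k planarSwap planarAdj_planarSwap]
    have hsqrt : Real.sqrt (1 - P.real (slabConn k (boxR a (a + n) c (c + n)) {z | z.1 = a} {z | z.1 = a + n})) ≤ δ₁ := by
      calc Real.sqrt (1 - P.real (slabConn k (boxR a (a + n) c (c + n)) {z | z.1 = a} {z | z.1 = a + n}))
          ≤ Real.sqrt (δ₁ ^ 2) := Real.sqrt_le_sqrt (by linarith)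
        _ = δ₁ := Real.sqrt_sq hδ₁0.le
    have hmono : P.real (slabConn k (boxR a (a + n) c (c + n)) (sideSeg a c (c + h)) {z | z.1 = a + n}) ≤
        P.real (E.Q.evAB k) :=
      measureReal_mono slabConn_subset_inter_target (measure_ne_top _ _)
    rw [hbt] at hsq
    rw [hswap] at hsq
    linarith
  -- hypothesis 2: the top-bottom crossing of `R`
  have hCD : 1 - δ₁ ≤ P.real (slabConn k E.R E.C {z | z.2 = c}) := by
    have hmono : P.real (slabConn k (boxR a (a + n) c d') {z | z.2 = d'} {z | z.2 = c}) ≤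
        P.real (slabConn k E.R E.C {z | z.2 = c}) := by
      refine measureReal_mono (fun ω hω => ?_) (measure_ne_top _ _)
      have h1 := slabConn_subset_inter_source hω
      refine slabConn_mono_sets subset_rfl (fun z hz => ?_) subset_rfl h1
      have hz1 : z ∈ boxR a (a + n) c d' := hz.1
      rw [mem_boxR_iff] at hz1
      exact ⟨hz.2, hz1.1, hz1.2.1⟩
    linarith
  have hres := hmain (by linarith) (by linarith)
  -- the conclusion: `C ⟷^R A` inside `{y = d'} ⟷^R A`
  refine hres.trans (measureReal_mono (slabConn_mono_sets subset_rfl (fun z hz => ?_) subset_rfl) (measure_ne_top _ _))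
  exact hz.1

/-- Reflected rows: `planarFlip t '' {y = s} = {y = t - s}`. [cite: NewmanTassionWu2017, §3.3 ("invariance under reflection")] -/
theorem image_planarFlip_row (t s : ℤ) : planarFlip t '' {z : ℤ × ℤ | z.2 = s} = {z | z.2 = t - s} := by
  ext w
  rw [Set.mem_image_equiv]
  simp only [planarFlip_symm, planarFlip_apply, Set.mem_setOf_eq]
  omega

/-- Rows are invariant under the vertical-axis reflection. [cite: NewmanTassionWu2017, §3.3 ("invariance under reflection")] -/
theorem image_planarReflect_row (t s : ℤ) : planarReflect t '' {z : ℤ × ℤ | z.2 = s} = {z | z.2 = s} := by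
  rw [image_planarReflect_eq]; ext z; simp only [Set.mem_setOf_eq]

/-- **(3.28), mirror image**: the top row of the tall rectangle `[a,a+n]×[c,d']` is joined inside it to
the lower-RIGHT segment `{a+n} × [c, c+h]` with probability `≥ 1-η` whenever the rectangle is crossed
top-to-bottom with probability `≥ 1-δ` (same side conditions).
[cite: NewmanTassionWu2017, Proposition 3.9 (proof, (3.28); "invariance under reflection")] -/
theorem top_rightLow_highProb (k ρ : ℕ) (hk : 1 ≤ k) (hρ : 2 ≤ ρ) {ε : ℝ} (hε : 0 < ε) {η : ℝ} (hη : 0 < η) :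
    ∃ δ : ℝ, 0 < δ ∧ ∀ (a c d' : ℤ) (n h : ℕ), 3 ≤ n → n ≤ 2 * h + 1 → h ≤ n →
      c + n + h + 4 * ρ + 9 ≤ d' →
      ∀ (p : unitInterval), ε ≤ (p : ℝ) → (p : ℝ) ≤ 1 - ε →
      1 - δ ≤ (bondPercolation (slabGraph 3 k) p).real
        (slabConn k (boxR a (a + n) c d') {z | z.2 = d'} {z | z.2 = c}) →
      1 - η ≤ (bondPercolation (slabGraph 3 k) p).real
        (slabConn k (boxR a (a + n) c d') {z | z.2 = d'} (sideSeg (a + n) c (c + h))) := by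
  obtain ⟨δ, hδ, H⟩ := top_leftLow_highProb k ρ hk hρ hε hη
  refine ⟨δ, hδ, fun a c d' n h hn hnh hhn hsep p hpε hp1 hTB => ?_⟩
  have h1 := H a c d' n h hn hnh hhn hsep p hpε hp1 hTB
  have hS : planarReflect (a + (a + n)) '' boxR a (a + n) c d' = boxR a (a + n) c d' :=
    image_planarReflect_boxR a (a + n) c d'
  have hX : planarReflect (a + (a + n)) '' {z : ℤ × ℤ | z.2 = d'} = {z | z.2 = d'} := image_planarReflect_row _ _
  have hY : planarReflect (a + (a + n)) '' sideSeg a c (c + h) = sideSeg (a + n) c (c + h) := by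
    rw [image_planarReflect_sideSeg, show a + (a + n) - a = a + n by ring]
  rw [← hS, ← hX, ← hY, real_slabConn_image k (planarReflect (a + (a + n))) (planarAdj_planarReflect _)]
  exact h1

/-- **(3.28), rotated by `π`**: the BOTTOM row of the tall rectangle `[a,a+n]×[c,d']` is joined inside
it to the upper-right segment `{a+n} × [d'-h, d']` with probability `≥ 1-η` whenever the rectangle is
crossed top-to-bottom with probability `≥ 1-δ` (same side conditions).
[cite: NewmanTassionWu2017, Proposition 3.9 (proof, (3.28); "invariance under reflection")] -/
theorem bottom_rightHigh_highProb (k ρ : ℕ) (hk : 1 ≤ k) (hρ : 2 ≤ ρ) {ε : ℝ} (hε : 0 < ε) {η : ℝ}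
    (hη : 0 < η) :
    ∃ δ : ℝ, 0 < δ ∧ ∀ (a c d' : ℤ) (n h : ℕ), 3 ≤ n → n ≤ 2 * h + 1 → h ≤ n →
      c + n + h + 4 * ρ + 9 ≤ d' →
      ∀ (p : unitInterval), ε ≤ (p : ℝ) → (p : ℝ) ≤ 1 - ε →
      1 - δ ≤ (bondPercolation (slabGraph 3 k) p).real
        (slabConn k (boxR a (a + n) c d') {z | z.2 = d'} {z | z.2 = c}) →
      1 - η ≤ (bondPercolation (slabGraph 3 k) p).real
        (slabConn k (boxR a (a + n) c d') {z | z.2 = c} (sideSeg (a + n) (d' - h) d')) := by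
  obtain ⟨δ, hδ, H⟩ := top_rightLow_highProb k ρ hk hρ hε hη
  refine ⟨δ, hδ, fun a c d' n h hn hnh hhn hsep p hpε hp1 hTB => ?_⟩
  have h1 := H a c d' n h hn hnh hhn hsep p hpε hp1 hTB
  have hS : planarFlip (c + d') '' boxR a (a + n) c d' = boxR a (a + n) c d' := image_planarFlip_boxR a (a + n) c d'
  have hX : planarFlip (c + d') '' {z : ℤ × ℤ | z.2 = d'} = {z | z.2 = c} := by
    rw [image_planarFlip_row, show c + d' - d' = c by ring]
  have hY : planarFlip (c + d') '' sideSeg (a + n) c (c + h) = sideSeg (a + n) (d' - h) d' := by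
    rw [image_planarFlip_sideSeg, show c + d' - (c + h) = d' - h by ring, show c + d' - c = d' by ring]
  rw [← hS, ← hX, ← hY, real_slabConn_image k (planarFlip (c + d')) (planarAdj_planarFlip _)]
  exact h1

/-! ## (3.29): extending the height -/

/-- **(3.29) in the high-probability regime**: for every `k ≥ 1`, `ρ ≥ 2`, `ε > 0`, `η > 0` there is
`δ > 0` such that for all widths `n` and heights `H ≤ H'` with `3 ≤ n ≤ 2h+1`, `1 ≤ h ≤ n`,
`n + h + 4ρ + 9 ≤ H`, `H + 4ρ + 10 ≤ H'`, `H' + 2h < 2H`, and every `p ∈ [ε,1-ε]`: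
`f_p(H, n) ≥ 1 - δ ⟹ f_p(H', n) ≥ 1 - η`. Proof: in `R' = [a,a+n]×[c,c+H']` take `S = [a,a+n]×[c,c+H+2ρ+6]`,
the target `B = {a+n}×[c+H-h, c+H]` and `D' = {a+n}×[c+H'-H, c+H'-H+h]`; the minimal open path from the
bottom row to `B` inside `S̄` (probability `≥ 1-δ'` by (3.28) rotated, in the sub-rectangle of height
`H`) is glued to the top-row cluster reaching `D'` (probability `≥ 1-δ'` by (3.28) reflected, in the upper
sub-rectangle of height `H`); the two segments are interleaved, so the paths cross (`glue0_highProb_segExt`).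
[cite: NewmanTassionWu2017, Proposition 3.9 (1) (proof, (3.29))] -/
theorem tb_extend_highProb (k ρ : ℕ) (hk : 1 ≤ k) (hρ : 2 ≤ ρ) {ε : ℝ} (hε : 0 < ε) {η : ℝ} (hη : 0 < η) :
    ∃ δ : ℝ, 0 < δ ∧ ∀ (n h H H' : ℕ), 3 ≤ n → n ≤ 2 * h + 1 → 1 ≤ h → h ≤ n →
      n + h + 4 * ρ + 9 ≤ H → H + 4 * ρ + 10 ≤ H' → H' + 2 * h < 2 * H →
      ∀ (p : unitInterval), ε ≤ (p : ℝ) → (p : ℝ) ≤ 1 - ε →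
      1 - δ ≤ crossingProb k p H n → 1 - η ≤ crossingProb k p H' n := by
  obtain ⟨δg, hδg, Hg⟩ := glue0_highProb_segExt k ρ hk hρ hε hη
  obtain ⟨δ₁, hδ₁, H₁⟩ := bottom_rightHigh_highProb k ρ hk hρ hε hδg
  obtain ⟨δ₂, hδ₂, H₂⟩ := top_rightLow_highProb k ρ hk hρ hε hδg
  refine ⟨min δ₁ δ₂, lt_min hδ₁ hδ₂, fun n h H H' hn hnh h1 hhn hH hHH' hint p hpε hp1 hf => ?_⟩
  set P := bondPercolation (slabGraph 3 k) p with hP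
  -- coordinates: `a = 0`, `c = 0`
  have hf1 : 1 - δ₁ ≤ P.real (slabConn k (boxR 0 (0 + n) 0 (0 + H)) {z | z.2 = 0 + H} {z | z.2 = 0}) := by
    rw [real_tb_eq_crossingProb]; exact (sub_le_sub_left (min_le_left _ _) _).trans hf
  have hf2 : 1 - δ₂ ≤ P.real (slabConn k (boxR 0 (0 + n) ((H' : ℤ) - H) ((H' : ℤ) - H + H))
      {z | z.2 = (H' : ℤ) - H + H} {z | z.2 = (H' : ℤ) - H}) := by
    rw [real_tb_eq_crossingProb]; exact (sub_le_sub_left (min_le_right _ _) _).trans hf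
  -- hypothesis 1: bottom row to the upper-right segment of the lower sub-rectangle of height `H`
  have hB := H₁ 0 0 (0 + H) n h hn hnh hhn (by omega) p hpε hp1 (by simpa using hf1)
  -- hypothesis 2: top row to the lower-right segment of the upper sub-rectangle of height `H`
  have hD := H₂ 0 ((H' : ℤ) - H) ((H' : ℤ) - H + H) n h hn hnh hhn (by omega) p hpε hp1 hf2
  -- the segment-target datum
  let W : SegExtSetup :=
    { a := 0, b := 0 + n, c := 0, d := H + 2 * ρ + 6, d' := H', y₁ := (H : ℤ) - h, y₂ := H
      A := {z | z.2 = 0 ∧ 0 ≤ z.1 ∧ z.1 ≤ 0 + n}, C := {z | z.2 = (H' : ℤ) ∧ 0 ≤ z.1 ∧ z.1 ≤ 0 + n}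
      hab := by omega, hcd := by omega, hdd' := by omega
      hy₁ := by omega, hy := by omega, hy₂ := by omega
      hA := by intro z hz; simp only [Set.mem_setOf_eq] at hz; rw [mem_boxR_iff]; omega
      hC := by intro z hz; simp only [Set.mem_setOf_eq] at hz; rw [mem_boxR_iff]; omega }
  have hmain := Hg W (sideSeg (0 + n) ((H' : ℤ) - H) ((H' : ℤ) - H + h)) ((H' : ℤ) - H + h)
    (by show (H : ℤ) + 2 * ρ + 6 ≤ H + 2 * ρ + 6; exact le_rfl)
    (fun z hz => hz.1) (fun z hz => hz.1) (fun z hz => ⟨hz.1, hz.2.2⟩)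
    (by show (H' : ℤ) - H + h < H - h; omega)
    (fun a' ha' c' hc' hmem => by
      simp only [W, Set.mem_setOf_eq] at ha' hc'
      rw [mem_sqBox_iff'] at hmem; push_cast at hmem; omega)
    (fun c' hc' s' hs' hmem => by
      simp only [W, Set.mem_setOf_eq] at hc'
      have hs'' : s' ∈ boxR (0 : ℤ) (0 + n) 0 (H + 2 * ρ + 6) := hs'
      rw [mem_boxR_iff] at hs''
      rw [mem_sqBox_iff'] at hmem; push_cast at hmem hs''; omega)
    p hpε hp1
  -- feed hypothesis 1
  have hAB : 1 - δg ≤ P.real (W.Q.evAB k) := by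
    refine hB.trans (measureReal_mono (fun ω hω => ?_) (measure_ne_top _ _))
    have hω1 := slabConn_subset_inter_source hω
    have hsub : boxR (0 : ℤ) (0 + n) 0 (0 + H) ⊆ W.S := by
      intro z hz; rw [mem_boxR_iff] at hz
      show z ∈ boxR (0 : ℤ) (0 + n) 0 (H + 2 * ρ + 6); rw [mem_boxR_iff]; omega
    refine slabConn_mono_sets hsub (fun z hz => ?_) (fun z hz => ?_) hω1
    · have hz1 : z ∈ boxR (0 : ℤ) (0 + n) 0 (0 + H) := hz.1
      rw [mem_boxR_iff] at hz1
      exact ⟨hz.2, hz1.1, hz1.2.1⟩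
    · simp only [sideSeg, Set.mem_setOf_eq] at hz
      show z.1 = 0 + (n : ℤ) ∧ (H : ℤ) - h ≤ z.2 ∧ z.2 ≤ H
      omega
  -- feed hypothesis 2
  have hCD : 1 - δg ≤ P.real (slabConn k W.R W.C (sideSeg (0 + n) ((H' : ℤ) - H) ((H' : ℤ) - H + h))) := by
    refine hD.trans (measureReal_mono (fun ω hω => ?_) (measure_ne_top _ _))
    have hω1 := slabConn_subset_inter_source hω
    have hsub : boxR (0 : ℤ) (0 + n) ((H' : ℤ) - H) ((H' : ℤ) - H + H) ⊆ W.R := by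
      intro z hz; rw [mem_boxR_iff] at hz
      show z ∈ boxR (0 : ℤ) (0 + n) 0 H'; rw [mem_boxR_iff]; omega
    refine slabConn_mono_sets hsub (fun z hz => ?_) subset_rfl hω1
    have hz1 : z ∈ boxR (0 : ℤ) (0 + n) ((H' : ℤ) - H) ((H' : ℤ) - H + H) := hz.1
    rw [mem_boxR_iff] at hz1
    have hz2 : z.2 = (H' : ℤ) - H + H := hz.2
    show z.2 = (H' : ℤ) ∧ 0 ≤ z.1 ∧ z.1 ≤ 0 + n
    refine ⟨by rw [hz2]; ring, hz1.1, hz1.2.1⟩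
  have hres := hmain hAB hCD
  -- the conclusion is the top-bottom crossing of `R'`
  rw [← real_tb_eq_crossingProb 0 0 n H' p]
  refine hres.trans (measureReal_mono (slabConn_mono_sets ?_ (fun z hz => ?_) (fun z hz => ?_)) (measure_ne_top _ _))
  · intro z hz
    have hz' : z ∈ boxR (0 : ℤ) (0 + n) 0 H' := hz
    rw [mem_boxR_iff] at hz' ⊢; omega
  · have : z.2 = (H' : ℤ) := hz.1
    show z.2 = 0 + (H' : ℤ); rw [this]; ring
  · exact hz.1

/-! ## Iteration: `f_p(jm, m-1)` -/

/-- **Prop. 3.9 (1) iterated, high-probability regime**: for every `k ≥ 1`, `ε > 0`, `j` and `η > 0`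
there is `δ > 0` such that for all `p ∈ [ε,1-ε]` and `m ≥ 40`:
`f_p(2m, m-1) ≥ 1-δ ⟹ f_p((j+2)m, m-1) ≥ 1-η` (`j` applications of (3.29), one block `m` each).
[cite: NewmanTassionWu2017, Proposition 3.9 (1) ("the more general statement … follows by induction")] -/
theorem crossingProb_highProb_iter (k : ℕ) (hk : 1 ≤ k) {ε : ℝ} (hε : 0 < ε) (j : ℕ) :
    ∀ {η : ℝ}, 0 < η → ∃ δ : ℝ, 0 < δ ∧ ∀ (p : unitInterval), ε ≤ (p : ℝ) → (p : ℝ) ≤ 1 - ε →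
      ∀ m : ℕ, 40 ≤ m → 1 - δ ≤ crossingProb k p (2 * m) (m - 1) →
      1 - η ≤ crossingProb k p ((j + 2) * m) (m - 1) := by
  induction j with
  | zero =>
    intro η hη
    exact ⟨η, hη, fun p _ _ m _ h => by simpa using h⟩
  | succ j ih =>
    intro η hη
    obtain ⟨δ₁, hδ₁, H₁⟩ := tb_extend_highProb k 2 hk le_rfl hε hη
    obtain ⟨δ, hδ, H⟩ := ih hδ₁
    refine ⟨δ, hδ, fun p hpε hp1 m hm hf => ?_⟩
    have hstep := H p hpε hp1 m hm hf
    have hH2 : 2 * m ≤ (j + 2) * m := Nat.mul_le_mul_right _ (by omega)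
    have heq : (j + 1 + 2) * m = (j + 2) * m + m := by ring
    rw [heq]
    exact H₁ (m - 1) ((m - 1) / 2) ((j + 2) * m) ((j + 2) * m + m) (by omega) (by omega) (by omega) (by omega)
      (by omega) (by omega) (by omega) p hpε hp1 hstep

/-- **NTW 2017, Proposition 3.9 (1) in the high-probability regime, `ε-δ` form** (the input `h39` of
the tree's assembly of Theorem 3.1): for every `k ≥ 1`, `ε > 0`, `η > 0`, `j` and `m₀ ≥ 40` there is
`δ > 0` such that for all `p ∈ [ε, 1-ε]` and `m ≥ m₀`: `f_p(2m, m-1) ≥ 1 - δ ⟹ f_p(jm, m-1) ≥ 1 - η`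
(any `j`; for `j ≤ 2` by monotonicity). [cite: NewmanTassionWu2017, Proposition 3.9 (1) (with h₂ ∈ 𝓗: h₂(x) → 1 as x → 1)] -/
theorem prop39_one_highProb (k : ℕ) (hk : 1 ≤ k) {ε : ℝ} (hε : 0 < ε) {η : ℝ} (hη : 0 < η) (j : ℕ)
    {m₀ : ℕ} (hm₀ : 40 ≤ m₀) :
    ∃ δ : ℝ, 0 < δ ∧ ∀ (p : unitInterval), ε ≤ (p : ℝ) → (p : ℝ) ≤ 1 - ε →
      ∀ m : ℕ, m₀ ≤ m → 1 - δ ≤ crossingProb k p (2 * m) (m - 1) → 1 - η ≤ crossingProb k p (j * m) (m - 1) := by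
  by_cases hj2 : j ≤ 2
  · refine ⟨η, hη, fun p _ _ m _ hf => hf.trans ?_⟩
    exact crossingProb_mono p (Nat.mul_le_mul_right _ hj2) le_rfl
  · obtain ⟨δ, hδ, H⟩ := crossingProb_highProb_iter k hk hε (j - 2) hη
    refine ⟨δ, hδ, fun p hpε hp1 m hm hf => ?_⟩
    have heq : (j - 2 + 2) * m = j * m := by rw [Nat.sub_add_cancel (by omega)]
    have := H p hpε hp1 m (hm₀.trans hm) hf
    rwa [heq] at this

end NTW17



end Literature.Probability.Percolation

end
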